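import Mathlib
import Literature.Combinatorics.SimpleGraph.LasserreStableBound
import Literature.Combinatorics.SimpleGraph.LasserreCliqueCover
import HarnessLib

/-!
# `PaleySosRung` (stmt-PneNP-9817), line `weil-patch-transfer`:
# Lasserre's bound `las⁽ᵗ⁾` is monotone under induced subgraphs

Stub `stub_inducedMonotone` of the line's skeleton (the transfer step, used as the last line of
the composition `PaleySosRung_of`): for an embedding `f : W ↪ V` and a finite graph `G` on `V`,
`las⁽ᵗ⁾(G.comap f) ≤ las⁽ᵗ⁾(G)` for `t ≥ 1`, where `G.comap f` (`Adj w w' ↔ G.Adj (f w) (f w')`)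
is the induced subgraph `G[range f]` pulled back to `W`, and `las⁽ᵗ⁾ = lasserreStableBound`
(`Literature/Combinatorics/SimpleGraph/LasserreStableBound.lean`, Laurent 2006, program (22)).

Proof (folklore, zero extension; same pattern as the tree's `lasserreStableBound_le_of_iso`):
by `lasserreStableBound_le_of_forall` it suffices to bound the value of every `y` that is
Lasserre-feasible for `G.comap f` at level `t`. Extend `y` by zero along `T ↦ T.map f`:
`y' (T.map f) = y T` and `y' S = 0` whenever `S ⊄ range f` (`Function.extend`). Then
* `y' ∅ = y ∅ = 1`;
* an edge `{f a, f b}` of `G` inside `range f` is an edge `{a, b}` of `G.comap f`, so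
  `y' {f a, f b} = y {a, b} = 0`, and on edges leaving `range f` the extension vanishes;
* the rows and columns of `M_t(y')` indexed by `S ⊄ range f` vanish (`S ∪ S' ⊆ range f` forces
  `S ⊆ range f`), so the quadratic form of `M_t(y')` at `x` equals the quadratic form of `M_t(y)`
  at `T ↦ x (T.map f)` (reindexing the surviving terms along the injection `T ↦ T.map f`), which
  is `≥ 0`;
* the value is unchanged: `Σ_v y' {v} = Σ_w y' {f w} = Σ_w y {w}`.
Hence `Σ_w y {w} ≤ las⁽ᵗ⁾(G)` by `IsLasserreFeasible.sum_singleton_le_lasserreStableBound`.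
-/

set_option linter.dupNamespace false -- `Summit.PneNP.PneNP.…`: summit = sub-problem (D-0017)

namespace Summit.PneNP.PneNP.Theorems.PaleySosRungWeilPatchTransfer

open Literature.Combinatorics.SimpleGraph Finset Matrix

/-- **Induced-subgraph monotonicity of `las⁽ᵗ⁾`**: for an embedding `f : W ↪ V` and `t ≥ 1`,
`las⁽ᵗ⁾(G.comap f) ≤ las⁽ᵗ⁾(G)` — every Lasserre-feasible `y` of `G.comap f` extends by zero
(`y' (T.map f) = y T`, `y' S = 0` for `S ⊄ range f`) to a feasible vector of `G` with the same
value. [folklore; Laurent2006 §3.1 (22)] -/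
theorem stub_inducedMonotone :
    ∀ {V W : Type*} [Fintype V] [DecidableEq V] [Fintype W] [DecidableEq W]
      (G : SimpleGraph V) (f : W ↪ V) {t : ℕ}, 1 ≤ t →
      lasserreStableBound (G.comap f) t ≤ lasserreStableBound G t := by
  intro V W _ _ _ _ G f t ht
  refine lasserreStableBound_le_of_forall fun y hy => ?_
  -- the zero extension `y'` of `y` along `T ↦ T.map f`
  obtain ⟨y', hmap, hout⟩ : ∃ y' : Finset V → ℝ, (∀ T : Finset W, y' (T.map f) = y T) ∧
      ∀ S : Finset V, ¬ S ⊆ univ.map f → y' S = 0 :=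
    ⟨Function.extend (fun T : Finset W => T.map f) y (fun _ => (0 : ℝ)),
      fun T => (Finset.map_injective f).extend_apply y _ T,
      fun S hS => Function.extend_apply' y _ S fun ⟨T, hT⟩ =>
        hS (hT ▸ Finset.map_subset_map.2 (subset_univ T))⟩
  -- the index injection `P_t(W) ↪ P_t(V)`, `T ↦ T.map f`
  obtain ⟨ι, hι, hιval⟩ : ∃ ι : {T : Finset W // T.card ≤ t} → {S : Finset V // S.card ≤ t},
      Function.Injective ι ∧ ∀ T, (ι T).1 = T.1.map f :=
    ⟨fun T => ⟨T.1.map f, (card_map f).trans_le T.2⟩,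
      fun T T' h => Subtype.ext (Finset.map_injective f (congrArg Subtype.val h)), fun _ => rfl⟩
  -- sums over `P_t(V)` of functions vanishing off the subsets of `range f` are sums over `P_t(W)`
  have hsum : ∀ F : {S : Finset V // S.card ≤ t} → ℝ,
      (∀ S, ¬ S.1 ⊆ univ.map f → F S = 0) → ∑ S, F S = ∑ T, F (ι T) := by
    intro F hF
    refine (Fintype.sum_of_injective ι hι _ _ (fun S hS => hF S fun hSf => hS ?_) fun _ => rfl).symm
    obtain ⟨u, -, hu⟩ := Finset.subset_map_iff.1 hSf
    exact ⟨⟨u, by rw [← card_map f, ← hu]; exact S.2⟩, Subtype.ext ((hιval _).trans hu.symm)⟩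
  have hy' : IsLasserreFeasible G t y' := by
    refine ⟨?_, ?_, ?_⟩
    · have h := hmap ∅
      rw [Finset.map_empty] at h
      rw [h, hy.empty_eq_one]
    · intro u v huv
      by_cases h : ({u, v} : Finset V) ⊆ univ.map f
      · obtain ⟨a, -, rfl⟩ := Finset.mem_map.1 (h (mem_insert_self u {v}))
        obtain ⟨b, -, rfl⟩ := Finset.mem_map.1 (h (mem_insert_of_mem (mem_singleton_self _)))
        rw [← Finset.map_singleton f b, ← Finset.map_insert, hmap]
        exact hy.pair_eq_zero (SimpleGraph.comap_adj.2 huv)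
      · exact hout _ h
    · refine Matrix.PosSemidef.of_dotProduct_mulVec_nonneg
        (Matrix.IsHermitian.ext fun I J => ?_) fun x => ?_
      · simp only [momentMatrix_apply, star_trivial, union_comm]
      · -- the quadratic form of `M_t(y')` at `x` is that of `M_t(y)` at `x ∘ ι`
        have hq : star x ⬝ᵥ (momentMatrix t y' *ᵥ x) =
            star (x ∘ ι) ⬝ᵥ (momentMatrix t y *ᵥ (x ∘ ι)) := by
          simp only [star_trivial, dotProduct, mulVec, momentMatrix_apply, Function.comp_apply]
          rw [hsum _ ?_]
          · refine Finset.sum_congr rfl fun T _ => ?_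
            rw [hsum _ ?_]
            · simp only [hιval, ← Finset.map_union, hmap]
            · intro S' hS'
              rw [hout _ fun h' => hS' (union_subset_iff.1 h').2, zero_mul]
          · intro S hS
            exact mul_eq_zero_of_right _ (Finset.sum_eq_zero fun S' _ => by
              rw [hout _ fun h' => hS (union_subset_iff.1 h').1, zero_mul])
        rw [hq]
        exact hy.posSemidef.dotProduct_mulVec_nonneg _
  -- the value is unchanged
  have hval : ∑ v, y' {v} = ∑ w, y {w} := by
    refine (Fintype.sum_of_injective f f.injective (fun w => y {w}) (fun v => y' {v})
      (fun v hv => hout _ fun h => hv ?_) fun w => ?_).symm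
    · obtain ⟨w, -, hw⟩ := Finset.mem_map.1 (h (mem_singleton_self v))
      exact ⟨w, hw⟩
    · rw [← Finset.map_singleton f w, hmap]
  rw [← hval]
  exact hy'.sum_singleton_le_lasserreStableBound ht

end Summit.PneNP.PneNP.Theorems.PaleySosRungWeilPatchTransfer
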